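import Literature.NumberTheory.EllipticCurves.KatoFineSelmerDual
import Literature.NumberTheory.EllipticCurves.Sha
import Literature.NumberTheory.EllipticCurves.MordellWeil
import Literature.NumberTheory.EllipticCurves.Tamagawa
import Mathlib.RingTheory.AdicCompletion.Algebra
import HarnessLib

/-!
# Ray–Sujatha 2023, Cor. 2.7 (Wuthrich's leading-term formula for the fine Selmer group, rank ≤ 1):
# `μ = λ = 0` for `R(E/ℚ_∞)` from `p ∤ c_ℓ`, `Ж = 0`, `Tors_{ℤ_p} D = 0` — ONE named fact, statement
# only (good-reduction special case), with the one notion its statement needs: the cokernel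
# `D_{E,p}` of `E(ℚ) ⊗ ℤ_p → Ê(ℚ_p)`

Topic `NumberTheory/EllipticCurves` (namespace = path, sub-namespace `RaySujatha2023` for the paper; the
general notion `Ê(ℚ_p)` / `D_{E,p}` is a dot-notation extension of Mathlib's `WeierstrassCurve`).  Written by the typer
seat of cell `bsd-f3-mu` (D-0131 (3); refuter `-ref2` g4 W07 / g5 M23: «file RS23 Cor 2.7 as a Literature
fact — it is the PRINTED hypothesis set of the cell's fine Mordell–Weil certificate», MEMO-desc §11;
CANDIDATES §4 row F-ref2-1).  Nothing is asserted; no `_holds` (the proof is Wuthrich's Euler-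
characteristic / leading-term formula for the fine Selmer group, J. Algebraic Geom. 16 (2007) — source
wanted, acq-01986, cite-only — restated as Ray–Sujatha's Thm. 2.6; size L).

## Source (held text `paper:arxiv-2112.13335` = A. Ray, R. Sujatha, *Arithmetic statistics for the
## fine Selmer group in Iwasawa theory*, Res. Number Theory 9 (2023); §2, chunks p0005–p0007, p0012;
## read 2026-08-27)

Setting (§2, p0005 L10): «Let `E` be an elliptic curve defined over `ℚ` and `p` an odd prime at which `E`
has good reduction» (the section's standing assumption); `R(E/L)` the fine Selmer group (Def. 2.1: kernel of
`H¹(ℚ_S/L, E[p^∞]) → ⊕_{ℓ ∈ S} K_ℓ(E[p^∞]/L)`), `R(E/ℚ_∞) = lim_n R(E/ℚ_n)` over the cyclotomic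
`ℤ_p`-extension (Def. 2.2), `μ`, `λ` = the Iwasawa invariants of its Pontryagin dual (structure theorem,
p0005).  p0006: «the fine Tate–Shafarevich group `Ж_{p^∞}(E/ℚ)` is the cokernel of `M(E/ℚ) → R(E/ℚ)`»
(`M` = the classes in the image of the Kummer map), «naturally identified with a subgroup of
`Ш(E/ℚ)[p^∞]`».  **Thm. 2.5 (Wuthrich).** «`Ж_{p^∞}(E/ℚ) ≠ 0` precisely when `Ш(E/ℚ)[p^∞] ≠ 0`.
Furthermore, if `rank E(ℚ) > 0`, then `Ж_{p^∞}(E/ℚ) = Ш(E/ℚ)[p^∞]`.»  «We let `D = D_{E,p}` be the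
cokernel of the natural map `E(ℚ) ⊗ ℤ_p` to the `p`-adic completion of `E(ℚ_p)`» (§4, p0012: «the
`p`-adic completion of `E(ℚ_p)` given by `Ê(ℚ_p) := lim_n E(ℚ_p)/pⁿE(ℚ_p)` … decomposes into a direct
sum `ℤ_p ⊕ T`»).  **Thm. 2.6 (Wuthrich).** «Let `E` be an elliptic curve over `ℚ` with potentially good
reduction at `p`.  Assume that (i) `R(E/ℚ_∞)` is a cotorsion `Λ`-module; (ii) the fine Tate–Shafarevich
group `Ж_{p^∞}(E/ℚ)` is finite; (iii) the cyclotomic height pairing on `R(E/ℚ)` is nondegenerate.  Then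
`r = max(0, rank E(ℚ) − 1)` and `a_r ∼ Reg × (#Tors_{ℤ_p}(D) × ∏_{ℓ ≠ p} c_ℓ(E) × #Ж_{p^∞}(E/ℚ)) / #J`.»
«Note that under the assumptions of the above theorem, `r = 0` and the regulator `Reg = 1` when
`rank E(ℚ) ≤ 1`.»  **Cor. 2.7.** «Let `E` be an elliptic curve over `ℚ` and `p` an odd prime.  Assume
that `E` has potentially good reduction at `p` and satisfies the conditions of Theorem 2.6.  Furthermore,
assume that the following conditions hold: `rank E(ℚ) ≤ 1`; `p ∤ c_ℓ(E)` for all primes `ℓ ≠ p`;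
`Ж_{p^∞}(E/ℚ) = 0`; `Tors_{ℤ_p}(D) = 0`.  Then the `μ` and `λ`-invariants of the fine Selmer group
`R(E/ℚ_∞)` are `0`.  In particular, `R(E/ℚ_∞)` has finite cardinality.»  (Proof printed: `r = 0`,
`Reg = 1`, `a_0` a unit, so the characteristic element is a unit of `Λ`.)

## Transcription (never stronger than print)

* `R(E/ℚ_∞)` = the tree's `W.fineSelmerInfty κ` for a cyclotomic `κ : ZpExtension ℚ p` (Greenberg's strict
  Selmer group with `M⁺ = 0`, = Coates–Sujatha's / Ray–Sujatha's fine Selmer group over `ℚ_∞`; module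
  docstring of `KatoFineSelmerDual`); its dual and `μ`, `λ` through the hypothesis structure
  `W.FineSelmerDualData κ γ` over a TOPOLOGICAL GENERATOR `γ` (`κ.IsTopGenerator γ`) and the tree's
  `muInvariant` / `lambdaInvariant`; condition (i) «cotorsion» = the guards `Module.Finite Λ Y.X`,
  `Module.IsTorsion Λ Y.X` on the datum the conclusion speaks about (all data are isomorphic);
  «finite cardinality» = `Finite Y.X` (the dual of a finite group), under the same guards.
* «potentially good reduction at `p`» is transcribed by the STRONGER hypothesis `W.HasGoodReductionAtPrime p`
  (good reduction at `p` — §2's standing assumption, p0005 L10, under which the paper's `R`, `S`, `D` are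
  set up); the typed fact is the good-reduction SPECIAL CASE of the printed corollary (weaker than print,
  never stronger; the cell's use is at good ordinary `p`).
* «`rank E(ℚ) ≤ 1`» = `W.mordellWeilRank ≤ 1`; «`p ∤ c_ℓ(E)` for all `ℓ ≠ p`» = per rational prime
  `ℓ ≠ p` on `(W.baseChange ℚ_[ℓ]).localTamagawaNumber ℤ_[ℓ]` (the tree's `c_ℓ`).
* «`Ж_{p^∞}(E/ℚ) = 0`» is transcribed as `Ш(E/ℚ)[p^∞] = 0` on the tree's `W.sha` — EQUIVALENT IN PRINT
  by Thm. 2.5 of the same paper (first sentence); it also discharges condition (ii) (`Ж ⊆ Ш[p^∞]`).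
* «`Tors_{ℤ_p}(D) = 0`» = `WeierstrassCurve.PadicCompletionCokernelTorsionFree` (below): `D = Ê(ℚ_p) ⧸
  (ℤ_p-span of the image of E(ℚ))`, `Ê(ℚ_p) = lim_n E(ℚ_p)/pⁿE(ℚ_p)` = Mathlib's `AdicCompletion` of the
  `ℤ`-module of `ℚ_p`-points at the ideal `(p)`, `ℤ_p` acting as `AdicCompletion (p) ℤ`; «no
  `ℤ_p`-torsion» is spelled «no `p`-torsion» (all `ℤ_p`-torsion is `p`-power torsion).
* Condition (iii) of Thm. 2.6 (non-degeneracy of the cyclotomic height pairing on `R(E/ℚ)`) concerns a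
  pairing on a group of `ℤ_p`-rank `r = max(0, rank E(ℚ) − 1)`, which is `0` under the corollary's own
  hypothesis `rank E(ℚ) ≤ 1` — «`r = 0` and the regulator `= 1` when `rank E(ℚ) ≤ 1`» (p0006) — so it
  is EMPTY here and is not transcribed (the tree has no notion for Wuthrich's pairing); the transcription
  is not stronger than print.  Flagged for the cell's literature refuter (REF2-LITMAP M23 (c) reads the
  clause the same way).
`-- TODO(general form): potentially good reduction at p (as printed in Cor. 2.7); Thm. 2.6 itself (the leading-term formula, any rank) once Wuthrich's cyclotomic height pairing on the fine Selmer group and the groups Ж, J are in the tree.`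

References: [RaySujatha2021] Thm. 2.5, Thm. 2.6, Cor. 2.7, §4 (arXiv:2112.13335); [Wuthrich2007JAG]
(original of Thm. 2.6 / Cor. 2.7); [CoatesSujatha2005] §3 (statement (A), which the conclusion implies).
-/

noncomputable section

open scoped Classical

open IsDedekindDomain NumberField

namespace WeierstrassCurve

variable (W : WeierstrassCurve ℚ) (p : ℕ)

/-! ### The notion: the `p`-adic completion `Ê(ℚ_p)` and the cokernel `D_{E,p}` -/

/-- **`Ê(ℚ_p) := lim_n E(ℚ_p)/pⁿE(ℚ_p)`**, the `p`-adic completion of the group of `ℚ_p`-points (Mathlib's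
`AdicCompletion` of the `ℤ`-module `E(ℚ_p) = (W.baseChange ℚ_[p]).toAffine.Point` at the ideal `(p)`;
a module over `ℤ_p = AdicCompletion (p) ℤ`).  Ray–Sujatha §4: «`Ê(ℚ_p)` decomposes into a direct sum
`ℤ_p ⊕ T`, where `T` is the torsion subgroup». [cite: RaySujatha2021, §4 before Lemma 4.7 (arXiv:2112.13335, definition of `Ê(ℚ_p)`)] -/
abbrev padicPointCompletion [Fact p.Prime] : Type :=
  AdicCompletion (Ideal.span {(p : ℤ)}) (W.baseChange ℚ_[p]).toAffine.Point

/-- The natural map `E(ℚ) → E(ℚ_p) → Ê(ℚ_p)` (base change of points followed by `AdicCompletion.of`).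
[cite: RaySujatha2021, §2 before Thm. 2.6 and §4 (the map `E(ℚ) ⊗ ℤ_p → Ê(ℚ_p)`)] -/
def toPadicPointCompletion [Fact p.Prime] : W.toAffine.Point →+ W.padicPointCompletion p :=
  (AdicCompletion.of (Ideal.span {(p : ℤ)}) (W.baseChange ℚ_[p]).toAffine.Point).toAddMonoidHom.comp
    (Affine.Point.baseChange (W' := W.toAffine) ℚ ℚ_[p])

/-- **`D = D_{E,p}`, the cokernel of `E(ℚ) ⊗ ℤ_p → Ê(ℚ_p)`**: the quotient of `Ê(ℚ_p)` by the
`ℤ_p`-span of the image of `E(ℚ)` (the image of `E(ℚ) ⊗ ℤ_p`, `ℤ_p = AdicCompletion (p) ℤ`).  At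
Mordell–Weil rank `0` it is `Ê(ℚ_p)` modulo rational torsion; at rank `1` with `Ê(ℚ_p) = ℤ_p ⊕ T` its
free part dies iff `φ_E : ℤ_p → ℤ_p` is an isomorphism (Ray–Sujatha §4, Lemma 4.7).
[cite: RaySujatha2021, §2 before Thm. 2.6 («`D = D_{E,p}` … the cokernel of the natural map `E(ℚ) ⊗ ℤ_p` to the `p`-adic completion of `E(ℚ_p)`») and §3–§4] -/
abbrev padicCompletionCokernel [Fact p.Prime] : Type :=
  W.padicPointCompletion p ⧸
    Submodule.span (AdicCompletion (Ideal.span {(p : ℤ)}) ℤ) (Set.range (W.toPadicPointCompletion p))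

/-- **`Tors_{ℤ_p}(D_{E,p}) = 0`**: the cokernel `D` has no `p`-torsion (all `ℤ_p`-torsion of a
`ℤ_p`-module is `p`-power torsion, so this is «the `ℤ_p`-torsion subgroup of `D` is trivial»).  «If
`rank E(ℚ) = 0` and `E(ℚ_p)` has no nontrivial `p`-torsion, then `Tors_{ℤ_p} D = 0`» (proof of Prop. 2.9);
at rank one with `E(ℚ_p)[p] = 0` (`T = 0`, `Ê(ℚ_p) ≅ ℤ_p`) it says that a generator of `E(ℚ)/tors` is not
divisible by `p` in `Ê(ℚ_p)` (`φ_E` an isomorphism, §4).  A predicate on the pair; nothing asserted. [cite: RaySujatha2021, Cor. 2.7 (hypothesis `Tors_{ℤ_p}(D) = 0`), Prop. 2.9 and §4 Lemma 4.7 (arXiv:2112.13335)] -/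
def PadicCompletionCokernelTorsionFree [Fact p.Prime] : Prop :=
  ∀ x : W.padicCompletionCokernel p, p • x = 0 → x = 0

end WeierstrassCurve

namespace Literature.NumberTheory.EllipticCurves.RaySujatha2023

open WeierstrassCurve

/-- **Ray–Sujatha 2023, Cor. 2.7 (of Wuthrich's leading-term formula, Thm. 2.6) — `μ = λ = 0` for the fine
Selmer group over `ℚ_∞` at Mordell–Weil rank ≤ 1 (good-reduction special case).**  Res. Number Theory 9 (2023), §2 Cor. 2.7
(arXiv:2112.13335): «Let `E` be an elliptic curve over `ℚ` and `p` an odd prime.  Assume that `E` has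
potentially good reduction at `p` and satisfies the conditions of Theorem 2.6 [(i) `R(E/ℚ_∞)` cotorsion,
(ii) `Ж_{p^∞}(E/ℚ)` finite, (iii) the cyclotomic height pairing on `R(E/ℚ)` nondegenerate].  Furthermore,
assume that: `rank E(ℚ) ≤ 1`; `p ∤ c_ℓ(E)` for all primes `ℓ ≠ p`; `Ж_{p^∞}(E/ℚ) = 0`; `Tors_{ℤ_p}(D) = 0`.
Then the `μ` and `λ`-invariants of the fine Selmer group `R(E/ℚ_∞)` are `0`.  In particular `R(E/ℚ_∞)`
has finite cardinality.»  Transcription (module docstring): «potentially good» ⟸ the STRONGER `good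
reduction at p` (§2's standing assumption; special case); (i) = the finitely-generated / torsion guards
on the dual datum `Y` the conclusion speaks about; `Ж = 0` as `Ш(E/ℚ)[p^∞] = 0` (equivalent by Thm. 2.5,
Wuthrich; it gives (ii)); (iii) is empty at rank ≤ 1 («`r = 0` and the regulator `= 1` when
`rank E(ℚ) ≤ 1`», loc. cit.) and is not transcribed; `D` = `padicCompletionCokernel`; conclusion =
`μ(Y) = 0 ∧ λ(Y) = 0 ∧ Y finite` for every finitely generated torsion dual fine Selmer datum over a
cyclotomic `κ` and a topological generator `γ`.  Never stronger than print; nothing asserted; no `_holds`.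
`-- TODO(general form): potentially good reduction at p; Thm. 2.6 (the leading-term formula `a_r ∼ Reg·#Tors D·∏c_ℓ·#Ж/#J`, any rank).`
[cite: RaySujatha2021, Cor. 2.7 with Thm. 2.5 and Thm. 2.6 (arXiv:2112.13335, §2)]
[cite: Wuthrich2007JAG, main theorem (the leading-term formula restated as Ray–Sujatha Thm. 2.6; cite-only, acq-01986)] -/
def cor27_fineSelmer_muInvariant_lambdaInvariant_eq_zero : Prop :=
  ∀ (W : WeierstrassCurve ℚ) [W.IsElliptic] (p : ℕ) [Fact p.Prime], p ≠ 2 →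
    W.HasGoodReductionAtPrime p →
    W.mordellWeilRank ≤ 1 →
    (∀ (ℓ : ℕ) (_ : Fact ℓ.Prime), ℓ ≠ p →
      ¬ p ∣ (W.baseChange ℚ_[ℓ]).localTamagawaNumber ℤ_[ℓ]) →
    (∀ c : W.galH1, c ∈ W.sha → ∀ n : ℕ, p ^ n • c = 0 → c = 0) →
    W.PadicCompletionCokernelTorsionFree p →
    ∀ (κ : ZpExtension ℚ p) (γ : Field.absoluteGaloisGroup ℚ), κ.IsCyclotomic → κ.IsTopGenerator γ →
      ∀ Y : W.FineSelmerDualData κ γ,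
        Module.Finite (IwasawaAlgebra p) Y.X → Module.IsTorsion (IwasawaAlgebra p) Y.X →
          muInvariant p Y.X = 0 ∧ lambdaInvariant p Y.X = 0 ∧ Finite Y.X

end Literature.NumberTheory.EllipticCurves.RaySujatha2023

end
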